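import Literature.NumberTheory.Sieve.MoebiusExpSum
import HarnessLib

/-!
# Vaughan's identity for `∑ μ(n) F(n)` and the inverse theorem for type I / type II sums

Topic `Literature/NumberTheory/Sieve`. Everything in this file is PROVED (theorems only; no
definitions, no named facts).

B. Green, T. Tao, *Quadratic uniformity of the Möbius function*, Ann. Inst. Fourier 58 (2008)
[GreenTao2008QuadraticMobius], §4: Lemma 4.1 (Vaughan's identity for `∑ μ(n) \overline{F(n)}`,
arbitrary bounded `F`) and Proposition 4.2 (= arXiv Prop. 9, "inverse theorem for
`E μ(n) \overline{f(n)}`": if the sum is large then EITHER for some dyadic `D` many `d ∼ D` have a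
large type I sum `∑_{w ≤ N/d} F(dw)`, OR for some dyadic `K` many `w` have a large type II
correlation `∑_{d ∼ K} F(dw) \overline{F(dw')}`). We use the three-term form of Vaughan's
identity already in the tree (`MoebiusExpSum.moebius_eq_three_terms`, with `U = V = u`) and sums
over `[1, N]` instead of `(N, 2N]`; the Cauchy–Schwarz / divisor-moment / dyadic-pigeonhole
bookkeeping is that of the source, with explicit constants.

Main results (namespace `Literature.NumberTheory.Sieve.QuadraticMoebius`):
* `sum_moebius_mul_eq_vaughan`, `norm_sum_moebius_mul_le_vaughan` — Vaughan's identity for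
  `∑_{n ≤ N} μ(n) F(n)` and the resulting bound `2u + |type I| + |type II|`;
* `typeI_inverse` — large type I sum ⇒ for some `j ≤ log₂ U`, at least `η² 2^j` integers
  `d ∈ [2^j, 2^{j+1})` have `‖∑_{w ≤ N/d} F(dw)‖ ≥ ηN/2^j`;
* `typeII_inverse` — large type II sum ⇒ for some dyadic `K` and some `w'`, at least
  `η(N/K) − 1` integers `w ≤ N/K`, `w ≠ w'`, have
  `‖∑_{K < d ≤ min(2K, N/w, N/w')} F(dw) \overline{F(dw')}‖ ≥ ηK`.

## References
* B. Green, T. Tao, Ann. Inst. Fourier 58 (2008) 1863–1935, §4 (Lemma 4.1, Proposition 4.2).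
  [GreenTao2008QuadraticMobius]
* M. B. Nathanson, *Additive Number Theory: the Classical Bases*, GTM 164, §8.5. [Nathanson1996]
-/

noncomputable section

open Finset Real ArithmeticFunction
open scoped ArithmeticFunction.Moebius ArithmeticFunction.zeta ArithmeticFunction.sigma
  ComplexConjugate

namespace Literature.NumberTheory.Sieve.QuadraticMoebius

open Literature.NumberTheory.Sieve (moebiusTrunc)
open Literature.NumberTheory.Sieve.Vaughan (gU arith_sub_apply gU_eq_zero_of_le abs_gU_le
  sum_sq_card_divisors_le)
open Literature.NumberTheory.Sieve.MoebiusExpSum (moebius_eq_three_terms moebius_sub_trunc_apply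
  abs_moebius_sub_trunc_le abs_trunc_mul_trunc_le trunc_mul_trunc_eq_zero_of_lt
  sum_sq_card_divisors_div_le)

/-! ### Vaughan's identity against an arbitrary test function -/

/-- Expansion of `∑_{n ≤ N} (f * g)(n) F(n) = ∑_{d ≤ N} f(d) ∑_{w ≤ N/d} g(w) F(dw)`. [folklore] -/
private theorem sum_mul_apply_mul_eq (f g : ArithmeticFunction ℝ) (N : ℕ) (F : ℕ → ℂ) :
    ∑ n ∈ Icc 1 N, (((f * g) n : ℝ) : ℂ) * F n =
      ∑ d ∈ Icc 1 N, ((f d : ℝ) : ℂ) * ∑ w ∈ Icc 1 (N / d), ((g w : ℝ) : ℂ) * F (d * w) := by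
  have h1 : ∀ n ∈ Icc 1 N, (((f * g) n : ℝ) : ℂ) * F n =
      ∑ p ∈ n.divisorsAntidiagonal, ((f p.1 : ℝ) : ℂ) * (((g p.2 : ℝ) : ℂ) * F (p.1 * p.2)) := by
    intro n _
    rw [ArithmeticFunction.mul_apply]
    push_cast
    rw [Finset.sum_mul]
    refine Finset.sum_congr rfl fun p hp => ?_
    rw [(Nat.mem_divisorsAntidiagonal.mp hp).1]
    ring
  rw [Finset.sum_congr rfl h1,
    Literature.NumberTheory.Sieve.SquarefreeSums.sum_Icc_sum_divisorsAntidiagonal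
      (fun d w : ℕ => ((f d : ℝ) : ℂ) * (((g w : ℝ) : ℂ) * F (d * w))) N]
  simp only [Finset.mul_sum]

/-- **Vaughan's identity** for `∑_{n ≤ N} μ(n) F(n)` (three-term form, `U = V = u`):
`∑ μF = 2 ∑ μ_u F − ∑_d (μ_u * μ_u)(d) ∑_{w ≤ N/d} F(dw) + ∑_d G_u(d) ∑_{w ≤ N/d} (μ − μ_u)(w) F(dw)`.
[cite: GreenTao2008QuadraticMobius, Lemma 4.1 (Vaughan's identity)] -/
theorem sum_moebius_mul_eq_vaughan (u N : ℕ) (F : ℕ → ℂ) :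
    ∑ n ∈ Icc 1 N, ((μ n : ℝ) : ℂ) * F n =
      2 * ∑ n ∈ Icc 1 N, (((moebiusTrunc u : ArithmeticFunction ℝ) n : ℝ) : ℂ) * F n -
      ∑ d ∈ Icc 1 N, ((((moebiusTrunc u : ArithmeticFunction ℝ) *
          (moebiusTrunc u : ArithmeticFunction ℝ)) d : ℝ) : ℂ) * ∑ w ∈ Icc 1 (N / d), F (d * w) +
      ∑ d ∈ Icc 1 N, ((gU u d : ℝ) : ℂ) * ∑ w ∈ Icc 1 (N / d),
        ((((μ : ArithmeticFunction ℝ) - (moebiusTrunc u : ArithmeticFunction ℝ)) w : ℝ) : ℂ) *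
          F (d * w) := by
  have hV := moebius_eq_three_terms u
  -- the pointwise identity, summed
  have h1 : ∑ n ∈ Icc 1 N, ((μ n : ℝ) : ℂ) * F n =
      ∑ n ∈ Icc 1 N, ((((moebiusTrunc u : ArithmeticFunction ℝ) n : ℝ) : ℂ) * F n +
        (((moebiusTrunc u : ArithmeticFunction ℝ) n : ℝ) : ℂ) * F n -
        (((((moebiusTrunc u : ArithmeticFunction ℝ) * (moebiusTrunc u : ArithmeticFunction ℝ) *
          (ζ : ArithmeticFunction ℝ)) n : ℝ) : ℂ)) * F n +
        ((((gU u * ((μ : ArithmeticFunction ℝ) -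
          (moebiusTrunc u : ArithmeticFunction ℝ))) n : ℝ) : ℂ)) * F n) := by
    refine Finset.sum_congr rfl fun n _ => ?_
    have h := congrArg (fun G : ArithmeticFunction ℝ => G n) hV
    simp only [ArithmeticFunction.add_apply, arith_sub_apply] at h
    rw [intCoe_apply (f := ArithmeticFunction.moebius)] at h
    have h' : ((μ n : ℝ) : ℂ) = ((((moebiusTrunc u : ArithmeticFunction ℝ) n : ℝ) : ℂ) +
        (((moebiusTrunc u : ArithmeticFunction ℝ) n : ℝ) : ℂ) -
        (((((moebiusTrunc u : ArithmeticFunction ℝ) * (moebiusTrunc u : ArithmeticFunction ℝ) *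
          (ζ : ArithmeticFunction ℝ)) n : ℝ) : ℂ)) +
        ((((gU u * ((μ : ArithmeticFunction ℝ) -
          (moebiusTrunc u : ArithmeticFunction ℝ))) n : ℝ) : ℂ))) := by
      exact_mod_cast h
    rw [h']; ring
  have h2 : ∑ n ∈ Icc 1 N, (((((moebiusTrunc u : ArithmeticFunction ℝ) *
        (moebiusTrunc u : ArithmeticFunction ℝ) * (ζ : ArithmeticFunction ℝ)) n : ℝ) : ℂ)) * F n =
      ∑ d ∈ Icc 1 N, ((((moebiusTrunc u : ArithmeticFunction ℝ) *
          (moebiusTrunc u : ArithmeticFunction ℝ)) d : ℝ) : ℂ) * ∑ w ∈ Icc 1 (N / d), F (d * w) := by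
    rw [sum_mul_apply_mul_eq]
    refine Finset.sum_congr rfl fun d _ => ?_
    congr 1
    refine Finset.sum_congr rfl fun w hw => ?_
    have hw1 : w ≠ 0 := by have := (Finset.mem_Icc.mp hw).1; omega
    rw [natCoe_apply, zeta_apply_ne hw1]
    push_cast
    ring
  rw [h1, Finset.sum_add_distrib, Finset.sum_sub_distrib, Finset.sum_add_distrib, ← two_mul,
    h2, sum_mul_apply_mul_eq (gU u) ((μ : ArithmeticFunction ℝ) -
      (moebiusTrunc u : ArithmeticFunction ℝ)) N F]

/-- `‖∑_{n ≤ N} μ_u(n) F(n)‖ ≤ u` for `1`-bounded `F`. [folklore] -/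
private theorem norm_sum_moebiusTrunc_mul_le (u N : ℕ) (F : ℕ → ℂ) (hF : ∀ n, ‖F n‖ ≤ 1) :
    ‖∑ n ∈ Icc 1 N, (((moebiusTrunc u : ArithmeticFunction ℝ) n : ℝ) : ℂ) * F n‖ ≤ u := by
  refine (norm_sum_le _ _).trans ?_
  calc ∑ n ∈ Icc 1 N, ‖(((moebiusTrunc u : ArithmeticFunction ℝ) n : ℝ) : ℂ) * F n‖
      ≤ ∑ n ∈ Icc 1 N, (if n ≤ u then (1 : ℝ) else 0) := by
        refine Finset.sum_le_sum fun n _ => ?_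
        rw [norm_mul, Complex.norm_real, Real.norm_eq_abs, intCoe_apply,
          Literature.NumberTheory.Sieve.moebiusTrunc_apply]
        split_ifs with h
        · calc |((μ n : ℤ) : ℝ)| * ‖F n‖ ≤ 1 * 1 := by
                refine mul_le_mul ?_ (hF n) (norm_nonneg _) zero_le_one
                exact_mod_cast abs_moebius_le_one
            _ = 1 := one_mul _
        · simp
    _ = #((Icc 1 N).filter (fun n => n ≤ u)) := by
        rw [Finset.sum_ite, Finset.sum_const_zero, add_zero, Finset.sum_const, nsmul_eq_mul,
          mul_one]
    _ ≤ #(Icc 1 u) := by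
        have hsub : (Icc 1 N).filter (fun n => n ≤ u) ⊆ Icc 1 u := by
          intro n hn; simp only [mem_filter, mem_Icc] at hn ⊢; omega
        exact_mod_cast Finset.card_le_card hsub
    _ = u := by simp

/-- **Vaughan's identity, as a bound**: for `1`-bounded `F`,
`‖∑_{n ≤ N} μ(n)F(n)‖ ≤ 2u + ‖type I‖ + ‖type II‖` with the type I coefficients
`a = μ_u * μ_u` (`|a| ≤ τ`, `a(d) = 0` for `d > u²`) and the type II coefficients `G_u`
(`|G_u| ≤ τ`, `= 0` on `[1, u]`) and `μ − μ_u` (`1`-bounded, `= 0` on `[1, u]`).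
[cite: GreenTao2008QuadraticMobius, Lemma 4.1 (Vaughan's identity)] -/
theorem norm_sum_moebius_mul_le_vaughan (u N : ℕ) (F : ℕ → ℂ) (hF : ∀ n, ‖F n‖ ≤ 1) :
    ‖∑ n ∈ Icc 1 N, ((μ n : ℝ) : ℂ) * F n‖ ≤ 2 * u +
      ‖∑ d ∈ Icc 1 N, ((((moebiusTrunc u : ArithmeticFunction ℝ) *
          (moebiusTrunc u : ArithmeticFunction ℝ)) d : ℝ) : ℂ) * ∑ w ∈ Icc 1 (N / d), F (d * w)‖ +
      ‖∑ d ∈ Icc 1 N, ((gU u d : ℝ) : ℂ) * ∑ w ∈ Icc 1 (N / d),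
        ((((μ : ArithmeticFunction ℝ) - (moebiusTrunc u : ArithmeticFunction ℝ)) w : ℝ) : ℂ) *
          F (d * w)‖ := by
  rw [sum_moebius_mul_eq_vaughan u N F]
  have hT := norm_sum_moebiusTrunc_mul_le u N F hF
  refine (norm_add_le _ _).trans (add_le_add ((norm_sub_le _ _).trans (add_le_add ?_ le_rfl))
    le_rfl)
  rw [norm_mul, Complex.norm_two]
  linarith

/-! ### The inverse theorem for type I sums -/

/-- A pigeonhole on a sum: if `∑_{j ∈ s} f j ≥ #s · X` then some `f j ≥ X`. [folklore] -/
private theorem exists_le_of_card_mul_le_sum {ι : Type*} (s : Finset ι) (hs : s.Nonempty)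
    (f : ι → ℝ) {X : ℝ} (h : #s * X ≤ ∑ j ∈ s, f j) : ∃ j ∈ s, X ≤ f j := by
  by_contra hc
  push Not at hc
  have : ∑ j ∈ s, f j < ∑ _j ∈ s, X := Finset.sum_lt_sum_of_nonempty hs fun j hj => hc j hj
  rw [Finset.sum_const, nsmul_eq_mul] at this
  linarith

/-- Counting a large subset from a second-moment bound: if `x_d ∈ [0, M]` for `d ∈ s`,
`#s ≤ D` and `∑_{d ∈ s} x_d² ≥ Y`, then `#{d ∈ s : x_d ≥ ηM} ≥ (Y − D η² M²)/M²`. [folklore] -/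
private theorem card_filter_ge_of_sum_sq {s : Finset ℕ} {x : ℕ → ℝ} {M D Y η : ℝ} (hM : 0 < M)
    (hx0 : ∀ d ∈ s, 0 ≤ x d) (hxM : ∀ d ∈ s, x d ≤ M) (hs : (#s : ℝ) ≤ D)
    (hY : Y ≤ ∑ d ∈ s, x d ^ 2) :
    (Y - D * (η * M) ^ 2) / M ^ 2 ≤ #(s.filter fun d => η * M ≤ x d) := by
  rw [div_le_iff₀ (by positivity)]
  have hsplit := Finset.sum_filter_add_sum_filter_not s (fun d => η * M ≤ x d) (fun d => x d ^ 2)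
  have h1 : ∑ d ∈ s.filter (fun d => η * M ≤ x d), x d ^ 2 ≤
      #(s.filter fun d => η * M ≤ x d) * M ^ 2 := by
    calc ∑ d ∈ s.filter (fun d => η * M ≤ x d), x d ^ 2
        ≤ ∑ _d ∈ s.filter (fun d => η * M ≤ x d), M ^ 2 := by
          refine Finset.sum_le_sum fun d hd => ?_
          have hd' := (Finset.mem_filter.mp hd).1
          exact pow_le_pow_left₀ (hx0 d hd') (hxM d hd') 2
      _ = _ := by rw [Finset.sum_const, nsmul_eq_mul]
  have h2 : ∑ d ∈ s.filter (fun d => ¬ η * M ≤ x d), x d ^ 2 ≤ D * (η * M) ^ 2 := by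
    calc ∑ d ∈ s.filter (fun d => ¬ η * M ≤ x d), x d ^ 2
        ≤ ∑ _d ∈ s.filter (fun d => ¬ η * M ≤ x d), (η * M) ^ 2 := by
          refine Finset.sum_le_sum fun d hd => ?_
          have hd' := Finset.mem_filter.mp hd
          exact pow_le_pow_left₀ (hx0 d hd'.1) (not_le.mp hd'.2).le 2
      _ = #(s.filter fun d => ¬ η * M ≤ x d) * (η * M) ^ 2 := by
          rw [Finset.sum_const, nsmul_eq_mul]
      _ ≤ D * (η * M) ^ 2 := by
          refine mul_le_mul_of_nonneg_right (le_trans ?_ hs) (by positivity)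
          exact_mod_cast Finset.card_filter_le _ _
  linarith

/-- **Inverse theorem for type I sums** (Green–Tao, AIF 2008, Proposition 4.2 = arXiv Prop. 9,
type I half, over `[1, N]`): let `|a(d)| ≤ τ(d)`, `a(d) = 0` for `d > U` (`1 ≤ U ≤ N`), `F`
`1`-bounded, `η > 0`. If `‖∑_{d ≤ N} a(d) ∑_{w ≤ N/d} F(dw)‖² ≥ 64 η² N² (1 + log U)⁴ (log₂U + 1)`
then for some `j ≤ log₂ U` at least `η² 2^j` integers `d ∈ [2^j, 2^{j+1}) ∩ [1, U]` satisfy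
`‖∑_{w ≤ N/d} F(dw)‖ ≥ η N/2^j` (Cauchy–Schwarz with `∑ τ(d)²/d ≤ (1 + log U)⁴`, dyadic
pigeonhole, and a second-moment count). [cite: GreenTao2008QuadraticMobius, Proposition 4.2
(inverse theorem for type I and II sums), type I case] -/
theorem typeI_inverse {N U : ℕ} (hU : 1 ≤ U) (hUN : U ≤ N) {a : ℕ → ℝ}
    (ha : ∀ d, |a d| ≤ #d.divisors) (ha0 : ∀ d, U < d → a d = 0)
    (F : ℕ → ℂ) (hF : ∀ n, ‖F n‖ ≤ 1) {η : ℝ} (hη : 0 < η)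
    (hlarge : 64 * η ^ 2 * (N : ℝ) ^ 2 * (1 + Real.log U) ^ 4 * (Nat.log 2 U + 1) ≤
      ‖∑ d ∈ Icc 1 N, (a d : ℂ) * ∑ w ∈ Icc 1 (N / d), F (d * w)‖ ^ 2) :
    ∃ j : ℕ, j ≤ Nat.log 2 U ∧
      η ^ 2 * 2 ^ j ≤ #((Icc 1 U).filter fun d => Nat.log 2 d = j ∧
        η * N / 2 ^ j ≤ ‖∑ w ∈ Icc 1 (N / d), F (d * w)‖) := by
  classical
  set S : ℕ → ℂ := fun d => ∑ w ∈ Icc 1 (N / d), F (d * w) with hSdef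
  set J : ℕ := Nat.log 2 U with hJ
  have hN0 : (0 : ℝ) < N := by exact_mod_cast (lt_of_lt_of_le Nat.one_pos (hU.trans hUN))
  have hU0 : (0 : ℝ) < U := by exact_mod_cast hU
  have hlogU : 0 ≤ 1 + Real.log U := by
    have := Real.log_nonneg (show (1 : ℝ) ≤ U by exact_mod_cast hU); linarith
  have hlogU1 : 1 ≤ 1 + Real.log U := by
    have := Real.log_nonneg (show (1 : ℝ) ≤ U by exact_mod_cast hU); linarith
  -- `‖S d‖ ≤ N/d`
  have hSle : ∀ d : ℕ, 1 ≤ d → ‖S d‖ ≤ (N : ℝ) / d := by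
    intro d hd
    calc ‖S d‖ ≤ ∑ w ∈ Icc 1 (N / d), ‖F (d * w)‖ := norm_sum_le _ _
      _ ≤ ∑ _w ∈ Icc 1 (N / d), (1 : ℝ) := Finset.sum_le_sum fun w _ => hF _
      _ = ((N / d : ℕ) : ℝ) := by simp
      _ ≤ (N : ℝ) / d := Nat.cast_div_le
  -- Step 1: restrict to `d ≤ U` and use `|a| ≤ τ`
  have h1 : ‖∑ d ∈ Icc 1 N, (a d : ℂ) * S d‖ ≤ ∑ d ∈ Icc 1 U, (#d.divisors : ℝ) * ‖S d‖ := by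
    have hsub : Icc 1 U ⊆ Icc 1 N := by
      intro d hd; simp only [mem_Icc] at hd ⊢; omega
    rw [← Finset.sum_subset hsub]
    · refine (norm_sum_le _ _).trans (Finset.sum_le_sum fun d _ => ?_)
      rw [norm_mul, Complex.norm_real, Real.norm_eq_abs]
      exact mul_le_mul_of_nonneg_right (ha d) (norm_nonneg _)
    · intro d hd hdU
      simp only [mem_Icc, not_and, not_le] at hd hdU
      rw [ha0 d (hdU hd.1)]; simp
  -- Step 2: Cauchy–Schwarz with `∑ τ²/d ≤ (1 + log U)⁴`
  have h2 : (∑ d ∈ Icc 1 U, (#d.divisors : ℝ) * ‖S d‖) ^ 2 ≤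
      (1 + Real.log U) ^ 4 * ∑ d ∈ Icc 1 U, (d : ℝ) * ‖S d‖ ^ 2 := by
    have hsplit : ∀ d ∈ Icc 1 U, (#d.divisors : ℝ) * ‖S d‖ =
        ((#d.divisors : ℝ) / Real.sqrt d) * (Real.sqrt d * ‖S d‖) := by
      intro d hd
      have hd0 : (0 : ℝ) < d := by exact_mod_cast (mem_Icc.mp hd).1
      have hs : Real.sqrt d ≠ 0 := (Real.sqrt_pos.2 hd0).ne'
      field_simp
    rw [Finset.sum_congr rfl hsplit]
    refine (Finset.sum_mul_sq_le_sq_mul_sq (Icc 1 U) _ _).trans ?_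
    have hA : ∑ d ∈ Icc 1 U, ((#d.divisors : ℝ) / Real.sqrt d) ^ 2 ≤ (1 + Real.log U) ^ 4 := by
      have hIoc : Icc 1 U = Ioc 0 U := by ext d; simp only [mem_Ioc, mem_Icc]; omega
      rw [hIoc]
      refine le_trans (le_of_eq (Finset.sum_congr rfl fun d hd => ?_))
        (sum_sq_card_divisors_div_le U)
      have hd0 : (0 : ℝ) < d := by exact_mod_cast (mem_Ioc.mp hd).1
      rw [div_pow, Real.sq_sqrt hd0.le]
    have hB : ∑ d ∈ Icc 1 U, (Real.sqrt d * ‖S d‖) ^ 2 = ∑ d ∈ Icc 1 U, (d : ℝ) * ‖S d‖ ^ 2 := by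
      refine Finset.sum_congr rfl fun d hd => ?_
      have hd0 : (0 : ℝ) < d := by exact_mod_cast (mem_Icc.mp hd).1
      rw [mul_pow, Real.sq_sqrt hd0.le]
    rw [hB]
    exact mul_le_mul_of_nonneg_right hA (Finset.sum_nonneg fun d _ => by positivity)
  -- hence `∑_{d ≤ U} d ‖S d‖² ≥ 64 η² N² (J + 1)`
  have h3 : 64 * η ^ 2 * (N : ℝ) ^ 2 * (J + 1) ≤ ∑ d ∈ Icc 1 U, (d : ℝ) * ‖S d‖ ^ 2 := by
    have hL4 : 0 < (1 + Real.log U) ^ 4 := by positivity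
    have h := hlarge.trans ((pow_le_pow_left₀ (norm_nonneg _) h1 2).trans h2)
    rw [show 64 * η ^ 2 * (N : ℝ) ^ 2 * (1 + Real.log U) ^ 4 * (J + 1) =
      (1 + Real.log U) ^ 4 * (64 * η ^ 2 * (N : ℝ) ^ 2 * (J + 1)) by ring] at h
    exact le_of_mul_le_mul_left h hL4
  -- Step 3: dyadic pigeonhole on `j = log₂ d`
  have hfib : ∑ d ∈ Icc 1 U, (d : ℝ) * ‖S d‖ ^ 2 =
      ∑ j ∈ range (J + 1), ∑ d ∈ (Icc 1 U).filter (fun d => Nat.log 2 d = j),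
        (d : ℝ) * ‖S d‖ ^ 2 := by
    rw [Finset.sum_fiberwise_of_maps_to]
    intro d hd
    rw [Finset.mem_range]
    exact Nat.lt_succ_of_le (Nat.log_mono_right (mem_Icc.mp hd).2)
  obtain ⟨j, hj, hjsum⟩ := exists_le_of_card_mul_le_sum (range (J + 1)) ⟨0, by simp⟩
    (fun j => ∑ d ∈ (Icc 1 U).filter (fun d => Nat.log 2 d = j), (d : ℝ) * ‖S d‖ ^ 2)
    (X := 64 * η ^ 2 * (N : ℝ) ^ 2) (by
      rw [Finset.card_range, ← hfib]; push_cast; linarith)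
  refine ⟨j, Nat.le_of_lt_succ (Finset.mem_range.mp hj), ?_⟩
  -- Step 4: inside the block `B_j = [2^j, 2^{j+1}) ∩ [1, U]`
  set B := (Icc 1 U).filter (fun d => Nat.log 2 d = j) with hBdef
  set D : ℝ := (2 : ℝ) ^ j with hDdef
  have hD0 : 0 < D := by positivity
  have hmemB : ∀ d ∈ B, 1 ≤ d ∧ d ≤ U ∧ 2 ^ j ≤ d ∧ d < 2 ^ (j + 1) := by
    intro d hd
    rw [hBdef, Finset.mem_filter, mem_Icc] at hd
    obtain ⟨⟨hd1, hdU⟩, hdj⟩ := hd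
    refine ⟨hd1, hdU, ?_, ?_⟩
    · rw [← hdj]; exact Nat.pow_log_le_self 2 (by omega)
    · rw [← hdj]; exact Nat.lt_pow_succ_log_self (by norm_num) d
  have hcardB : (#B : ℝ) ≤ D := by
    have hsub : B ⊆ Ico (2 ^ j) (2 ^ (j + 1)) := by
      intro d hd
      have h := hmemB d hd
      rw [Finset.mem_Ico]; exact ⟨h.2.2.1, h.2.2.2⟩
    have := Finset.card_le_card hsub
    rw [Nat.card_Ico, pow_succ] at this
    have h2 : 2 ^ j * 2 - 2 ^ j = 2 ^ j := by omega
    rw [h2] at this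
    rw [hDdef]; exact_mod_cast this
  -- `∑_{B} ‖S d‖² ≥ 32 η² N² / D`
  have h4 : 32 * η ^ 2 * (N : ℝ) ^ 2 / D ≤ ∑ d ∈ B, ‖S d‖ ^ 2 := by
    have h5 : ∑ d ∈ B, (d : ℝ) * ‖S d‖ ^ 2 ≤ 2 * D * ∑ d ∈ B, ‖S d‖ ^ 2 := by
      rw [Finset.mul_sum]
      refine Finset.sum_le_sum fun d hd => ?_
      have h := (hmemB d hd).2.2.2
      have hd2 : (d : ℝ) ≤ 2 * D := by
        rw [hDdef]
        have : ((d : ℕ) : ℝ) < (2 : ℝ) ^ (j + 1) := by exact_mod_cast h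
        rw [pow_succ] at this; linarith
      exact mul_le_mul_of_nonneg_right hd2 (by positivity)
    rw [div_le_iff₀ hD0]
    have := hjsum.trans h5
    linarith
  -- Step 5: second-moment count
  have hcount := card_filter_ge_of_sum_sq (s := B) (x := fun d => ‖S d‖) (M := (N : ℝ) / D)
    (D := D) (Y := 32 * η ^ 2 * (N : ℝ) ^ 2 / D) (η := η) (by positivity)
    (fun d _ => norm_nonneg _) (fun d hd => by
      have h := hmemB d hd
      refine (hSle d h.1).trans ?_
      have : D ≤ (d : ℝ) := by rw [hDdef]; exact_mod_cast h.2.2.1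
      exact div_le_div_of_nonneg_left hN0.le hD0 this) hcardB h4
  have hsimp : (32 * η ^ 2 * (N : ℝ) ^ 2 / D - D * (η * (N / D)) ^ 2) / (N / D) ^ 2 =
      31 * η ^ 2 * D := by
    field_simp
    ring
  rw [hsimp] at hcount
  have hfilt : B.filter (fun d => η * (N / D) ≤ ‖S d‖) =
      (Icc 1 U).filter (fun d => Nat.log 2 d = j ∧ η * N / 2 ^ j ≤ ‖S d‖) := by
    rw [hBdef, Finset.filter_filter]
    refine Finset.filter_congr fun d _ => ?_
    rw [hDdef, mul_div_assoc]
  rw [hfilt] at hcount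
  refine le_trans ?_ hcount
  rw [hDdef]
  nlinarith [pow_pos (show (0:ℝ) < 2 by norm_num) j, sq_nonneg η]

/-! ### The inverse theorem for type II sums -/

/-- **Inverse theorem for type II sums** (Green–Tao, AIF 2008, Proposition 4.2 = arXiv Prop. 9,
type II half, over `[1, N]`): let `|b(d)| ≤ τ(d)`, `b = 0` on `[1, u]`, `|c| ≤ 1`, `c = 0` on
`[1, u]` (`u ≥ 1`), `F` `1`-bounded, `η > 0`, `N ≥ 2`. If
`‖∑_{d ≤ N} b(d) ∑_{w ≤ N/d} c(w) F(dw)‖² ≥ 4 η N² (log₂N + 1)² (1 + log 2N)³`, then there are a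
dyadic scale `K` (`u ≤ K`, `Ku ≤ N`) and `w' ≤ N/K` such that at least `η (N/K) − 1` integers
`w ≤ N/K`, `w ≠ w'`, have `‖∑_{K < d ≤ min(2K, N/w, N/w')} F(dw) \overline{F(dw')}‖ ≥ η K`
(dyadic blocks, Cauchy–Schwarz with `∑_{d ≤ 2K} τ(d)² ≤ 2K(1 + log 2K)³`, expansion of the
square, popularity). [cite: GreenTao2008QuadraticMobius, Proposition 4.2 (inverse theorem for
type I and II sums), type II case] -/
theorem typeII_inverse {N u : ℕ} (hN : 2 ≤ N) (hu : 1 ≤ u) {b c : ℕ → ℝ}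
    (hb : ∀ d, |b d| ≤ #d.divisors) (hb0 : ∀ d, d ≤ u → b d = 0)
    (hc : ∀ w, |c w| ≤ 1) (hc0 : ∀ w, w ≤ u → c w = 0)
    (F : ℕ → ℂ) (hF : ∀ n, ‖F n‖ ≤ 1) {η : ℝ} (hη : 0 < η)
    (hlarge : 4 * η * (N : ℝ) ^ 2 * ((Nat.log 2 N : ℝ) + 1) ^ 2 * (1 + Real.log (2 * N)) ^ 3 ≤
      ‖∑ d ∈ Icc 1 N, (b d : ℂ) * ∑ w ∈ Icc 1 (N / d), (c w : ℂ) * F (d * w)‖ ^ 2) :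
    ∃ K : ℕ, u ≤ K ∧ K * u ≤ N ∧ ∃ w' ∈ Icc 1 (N / K),
      η * ((N / K : ℕ) : ℝ) - 1 ≤ #((Icc 1 (N / K)).filter fun w => w ≠ w' ∧
        η * K ≤ ‖∑ d ∈ Ioc K (min (2 * K) (min (N / w) (N / w'))),
          F (d * w) * conj (F (d * w'))‖) := by
  classical
  set T : ℕ → ℂ := fun d => ∑ w ∈ Icc 1 (N / d), (c w : ℂ) * F (d * w) with hTdef
  set h : ℕ := Nat.log 2 N + 1 with hh
  have hN0 : N ≠ 0 := by omega
  have hNr : (0 : ℝ) < N := by exact_mod_cast Nat.pos_of_ne_zero hN0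
  have hN1 : (1 : ℝ) ≤ N := by exact_mod_cast Nat.pos_of_ne_zero hN0
  have hNh : N ≤ u * 2 ^ h := by
    have h1 : N < 2 ^ h := Nat.lt_pow_succ_log_self (by norm_num) N
    have h2 : 2 ^ h ≤ u * 2 ^ h := Nat.le_mul_of_pos_left _ hu
    omega
  have hhr : (h : ℝ) = (Nat.log 2 N : ℝ) + 1 := by rw [hh]; push_cast; ring
  have hh0 : (0 : ℝ) < h := by rw [hhr]; positivity
  set ℓ : ℝ := 1 + Real.log (2 * N) with hℓ
  have hℓ1 : 1 ≤ ℓ := by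
    have := Real.log_nonneg (show (1 : ℝ) ≤ 2 * N by linarith only [hN1])
    rw [hℓ]; linarith only [this]
  set X : ℝ := ‖∑ d ∈ Icc 1 N, (b d : ℂ) * T d‖ with hXdef
  have hX2 : 4 * η * (N : ℝ) ^ 2 * (h : ℝ) ^ 2 * ℓ ^ 3 ≤ X ^ 2 := by rw [hhr]; exact hlarge
  have hXpos : 0 < X := by
    have h1 : 0 < X ^ 2 := lt_of_lt_of_le (by positivity) hX2
    by_contra hX
    have : X = 0 := le_antisymm (not_lt.mp hX) (norm_nonneg _)
    rw [this] at h1; simp at h1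
  -- Step 1: dyadic blocks and pigeonhole
  have hdy := Literature.NumberTheory.Sieve.Vinogradov.sum_Icc_eq_sum_dyadic hNh
    (fun d => (b d : ℂ) * T d) (fun k hk => by simp only [hb0 k hk]; simp)
    (fun k hk => by
      have : N / k = 0 := Nat.div_eq_of_lt hk
      simp only [hTdef, this]; simp)
  have hXle : X ≤ ∑ i ∈ range h, ‖∑ d ∈ Ioc (u * 2 ^ i) (u * 2 ^ i + u * 2 ^ i),
      (b d : ℂ) * T d‖ := by
    rw [hXdef]
    simp only [hTdef] at hdy ⊢
    rw [hdy]
    exact norm_sum_le _ _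
  obtain ⟨i, hi, hBlock⟩ := exists_le_of_card_mul_le_sum (range h) ⟨0, by simp [hh]⟩
    (fun i => ‖∑ d ∈ Ioc (u * 2 ^ i) (u * 2 ^ i + u * 2 ^ i), (b d : ℂ) * T d‖)
    (X := X / h) (by rw [Finset.card_range]; field_simp; exact hXle)
  set K : ℕ := u * 2 ^ i with hKdef
  have huK : u ≤ K := Nat.le_mul_of_pos_right u (Nat.two_pow_pos i)
  have hK1 : 1 ≤ K := hu.trans huK
  have hKr : (0 : ℝ) < K := by exact_mod_cast hK1
  have hK1r : (1 : ℝ) ≤ K := by exact_mod_cast hK1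
  have h2K : u * 2 ^ i + u * 2 ^ i = 2 * K := by rw [hKdef]; ring
  rw [h2K] at hBlock
  have hBpos : 0 < ‖∑ d ∈ Ioc K (2 * K), (b d : ℂ) * T d‖ :=
    lt_of_lt_of_le (by positivity) hBlock
  -- the block is non-zero, so `K u ≤ N`
  have hKu : K * u ≤ N := by
    by_contra hKu
    have hzero : ∑ d ∈ Ioc K (2 * K), (b d : ℂ) * T d = 0 := by
      refine Finset.sum_eq_zero fun d hd => ?_
      have hKd : K < d := (Finset.mem_Ioc.mp hd).1
      have hd0 : 0 < d := by omega
      have hNd : N / d < u := by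
        rw [Nat.div_lt_iff_lt_mul hd0]
        calc N < K * u := not_le.mp hKu
          _ ≤ u * d := by rw [mul_comm]; exact Nat.mul_le_mul_left u hKd.le
      have hT : T d = 0 := by
        simp only [hTdef]
        refine Finset.sum_eq_zero fun w hw => ?_
        have hwu : w ≤ u := by have := (Finset.mem_Icc.mp hw).2; omega
        rw [hc0 w hwu]; simp
      rw [hT, mul_zero]
    rw [hzero, norm_zero] at hBpos
    exact lt_irrefl _ hBpos
  have hKN : K ≤ N := le_trans (Nat.le_mul_of_pos_right K hu) hKu
  have hKNr : (K : ℝ) ≤ N := by exact_mod_cast hKN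
  -- Step 2: Cauchy–Schwarz on the block
  have hCS : ‖∑ d ∈ Ioc K (2 * K), (b d : ℂ) * T d‖ ^ 2 ≤
      (2 * K * ℓ ^ 3) * ∑ d ∈ Ioc K (2 * K), ‖T d‖ ^ 2 := by
    have h1 : ‖∑ d ∈ Ioc K (2 * K), (b d : ℂ) * T d‖ ≤
        ∑ d ∈ Ioc K (2 * K), (#d.divisors : ℝ) * ‖T d‖ := by
      refine (norm_sum_le _ _).trans (Finset.sum_le_sum fun d _ => ?_)
      rw [norm_mul, Complex.norm_real, Real.norm_eq_abs]
      exact mul_le_mul_of_nonneg_right (hb d) (norm_nonneg _)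
    refine (pow_le_pow_left₀ (norm_nonneg _) h1 2).trans ?_
    refine (Finset.sum_mul_sq_le_sq_mul_sq (Ioc K (2 * K)) _ _).trans ?_
    refine mul_le_mul_of_nonneg_right ?_ (Finset.sum_nonneg fun d _ => by positivity)
    have h2 : ∑ d ∈ Ioc K (2 * K), ((#d.divisors : ℕ) : ℝ) ^ 2 ≤
        ∑ d ∈ Ioc 0 (2 * K), ((#d.divisors : ℕ) : ℝ) ^ 2 :=
      Finset.sum_le_sum_of_subset_of_nonneg
        (Finset.Ioc_subset_Ioc_left (Nat.zero_le K)) fun _ _ _ => by positivity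
    refine h2.trans ((sum_sq_card_divisors_le (2 * K)).trans ?_)
    push_cast
    refine mul_le_mul_of_nonneg_left ?_ (by positivity)
    have h3 : 1 + Real.log (2 * (K : ℝ)) ≤ ℓ := by
      rw [hℓ]
      have := Real.log_le_log (by positivity) (show 2 * (K : ℝ) ≤ 2 * N by linarith only [hKNr])
      linarith only [this]
    have h4 : 0 ≤ 1 + Real.log (2 * (K : ℝ)) := by
      have := Real.log_nonneg (show (1 : ℝ) ≤ 2 * K by linarith only [hK1r])
      linarith only [this]
    exact pow_le_pow_left₀ h4 h3 3
  have hT2 : 2 * η * (N : ℝ) ^ 2 / K ≤ ∑ d ∈ Ioc K (2 * K), ‖T d‖ ^ 2 := by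
    have h1 : (X / h) ^ 2 ≤ (2 * K * ℓ ^ 3) * ∑ d ∈ Ioc K (2 * K), ‖T d‖ ^ 2 :=
      (pow_le_pow_left₀ (by positivity) hBlock 2).trans hCS
    have h2 : 4 * η * (N : ℝ) ^ 2 * ℓ ^ 3 ≤ (X / h) ^ 2 := by
      rw [div_pow, le_div_iff₀ (by positivity)]; linarith only [hX2]
    rw [div_le_iff₀ hKr]
    refine le_of_mul_le_mul_left ?_ (show (0 : ℝ) < 2 * ℓ ^ 3 by positivity)
    linarith only [h2.trans h1]
  -- Step 3: expand the squares
  set M : ℕ := N / K with hMdef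
  set z : ℕ → ℕ → ℂ := fun d w => if d * w ≤ N then F (d * w) else 0 with hzdef
  have hTz : ∀ d ∈ Ioc K (2 * K), T d = ∑ w ∈ Icc 1 M, (c w : ℂ) * z d w := by
    intro d hd
    have hKd : K < d := (Finset.mem_Ioc.mp hd).1
    have hd0 : 0 < d := by omega
    have hsub : Icc 1 (N / d) ⊆ Icc 1 M := by
      intro w hw
      rw [Finset.mem_Icc] at hw ⊢
      exact ⟨hw.1, hw.2.trans (Nat.div_le_div_left hKd.le hK1)⟩
    simp only [hTdef]
    rw [← Finset.sum_subset hsub]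
    · refine Finset.sum_congr rfl fun w hw => ?_
      have hwN : d * w ≤ N := by
        have := (Finset.mem_Icc.mp hw).2
        rw [mul_comm]; exact (Nat.le_div_iff_mul_le hd0).mp this
      simp only [hzdef, if_pos hwN]
    · intro w hwM hw'
      rw [Finset.mem_Icc, not_and, not_le] at hw'
      have hw1 : 1 ≤ w := (Finset.mem_Icc.mp hwM).1
      have hwN : ¬ d * w ≤ N := by
        intro hle
        have : w ≤ N / d := (Nat.le_div_iff_mul_le hd0).mpr (by rw [mul_comm]; exact hle)
        exact absurd (hw' hw1) (not_lt.mpr this)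
      simp only [hzdef, if_neg hwN, mul_zero]
  set W : ℕ → ℕ → ℂ := fun w w' => ∑ d ∈ Ioc K (2 * K), z d w * conj (z d w') with hWdef
  have hexp : ∑ d ∈ Ioc K (2 * K), ‖T d‖ ^ 2 =
      ∑ w ∈ Icc 1 M, ∑ w' ∈ Icc 1 M, c w * c w' * (W w w').re := by
    calc ∑ d ∈ Ioc K (2 * K), ‖T d‖ ^ 2
        = ∑ d ∈ Ioc K (2 * K), ∑ w ∈ Icc 1 M, ∑ w' ∈ Icc 1 M,
            c w * c w' * (z d w * conj (z d w')).re := by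
          refine Finset.sum_congr rfl fun d hd => ?_
          rw [hTz d hd]
          exact Literature.NumberTheory.Sieve.Vinogradov.norm_sq_sum_real_mul _ _ _
      _ = ∑ w ∈ Icc 1 M, ∑ d ∈ Ioc K (2 * K), ∑ w' ∈ Icc 1 M,
            c w * c w' * (z d w * conj (z d w')).re := Finset.sum_comm
      _ = ∑ w ∈ Icc 1 M, ∑ w' ∈ Icc 1 M, ∑ d ∈ Ioc K (2 * K),
            c w * c w' * (z d w * conj (z d w')).re :=
          Finset.sum_congr rfl fun w _ => Finset.sum_comm
      _ = _ := by
          refine Finset.sum_congr rfl fun w _ => Finset.sum_congr rfl fun w' _ => ?_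
          rw [hWdef]
          simp only [Complex.re_sum, Finset.mul_sum]
  have hWle : ∀ w w', ‖W w w'‖ ≤ K := by
    intro w w'
    calc ‖W w w'‖ ≤ ∑ d ∈ Ioc K (2 * K), ‖z d w * conj (z d w')‖ := norm_sum_le _ _
      _ ≤ ∑ _d ∈ Ioc K (2 * K), (1 : ℝ) := by
          refine Finset.sum_le_sum fun d _ => ?_
          rw [norm_mul, Complex.norm_conj]
          have hz : ∀ v, ‖z d v‖ ≤ 1 := by
            intro v; simp only [hzdef]; split_ifs
            · exact hF _
            · simp
          calc ‖z d w‖ * ‖z d w'‖ ≤ 1 * 1 :=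
                mul_le_mul (hz w) (hz w') (norm_nonneg _) zero_le_one
            _ = 1 := one_mul _
      _ = K := by
          rw [Finset.sum_const, Nat.card_Ioc, nsmul_eq_mul, mul_one]
          have : 2 * K - K = K := by omega
          rw [this]
  have hsumW : 2 * η * (N : ℝ) ^ 2 / K ≤ ∑ p ∈ Icc 1 M ×ˢ Icc 1 M, ‖W p.1 p.2‖ := by
    refine hT2.trans ?_
    rw [hexp, ← Finset.sum_product']
    refine Finset.sum_le_sum fun p _ => ?_
    calc c p.1 * c p.2 * (W p.1 p.2).re ≤ |c p.1 * c p.2 * (W p.1 p.2).re| := le_abs_self _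
      _ = |c p.1| * |c p.2| * |(W p.1 p.2).re| := by rw [abs_mul, abs_mul]
      _ ≤ 1 * 1 * ‖W p.1 p.2‖ := by
          refine mul_le_mul (mul_le_mul (hc _) (hc _) (abs_nonneg _) zero_le_one)
            (Complex.abs_re_le_norm _) (abs_nonneg _) (by norm_num)
      _ = ‖W p.1 p.2‖ := by ring
  -- Step 4: many good pairs
  have hMK : (M : ℝ) ≤ N / K := by rw [hMdef]; exact Nat.cast_div_le
  have hM1 : 1 ≤ M := by
    rw [hMdef]
    exact (Nat.le_div_iff_mul_le hK1).mpr (by rw [one_mul]; exact hKN)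
  set P := (Icc 1 M ×ˢ Icc 1 M).filter (fun p : ℕ × ℕ => η * K ≤ ‖W p.1 p.2‖) with hPdef
  have hPcard : η * (M : ℝ) ^ 2 ≤ #P := by
    have hsplit := Finset.sum_filter_add_sum_filter_not (Icc 1 M ×ˢ Icc 1 M)
      (fun p : ℕ × ℕ => η * K ≤ ‖W p.1 p.2‖) (fun p => ‖W p.1 p.2‖)
    have h1 : ∑ p ∈ P, ‖W p.1 p.2‖ ≤ #P * K := by
      calc ∑ p ∈ P, ‖W p.1 p.2‖ ≤ ∑ _p ∈ P, (K : ℝ) := Finset.sum_le_sum fun p _ => hWle _ _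
        _ = #P * K := by rw [Finset.sum_const, nsmul_eq_mul]
    have h2 : ∑ p ∈ (Icc 1 M ×ˢ Icc 1 M).filter (fun p : ℕ × ℕ => ¬ η * K ≤ ‖W p.1 p.2‖),
        ‖W p.1 p.2‖ ≤ (M : ℝ) ^ 2 * (η * K) := by
      calc _ ≤ ∑ _p ∈ (Icc 1 M ×ˢ Icc 1 M).filter (fun p : ℕ × ℕ => ¬ η * K ≤ ‖W p.1 p.2‖),
            η * K := Finset.sum_le_sum fun p hp => (not_le.mp (Finset.mem_filter.mp hp).2).le
        _ = #((Icc 1 M ×ˢ Icc 1 M).filter (fun p : ℕ × ℕ => ¬ η * K ≤ ‖W p.1 p.2‖)) *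
            (η * K) := by rw [Finset.sum_const, nsmul_eq_mul]
        _ ≤ (M : ℝ) ^ 2 * (η * K) := by
            refine mul_le_mul_of_nonneg_right ?_ (by positivity)
            have : #((Icc 1 M ×ˢ Icc 1 M).filter (fun p : ℕ × ℕ => ¬ η * K ≤ ‖W p.1 p.2‖)) ≤
                M ^ 2 := by
              calc _ ≤ #(Icc 1 M ×ˢ Icc 1 M) := Finset.card_filter_le _ _
                _ = M ^ 2 := by rw [Finset.card_product]; simp [sq]
            exact_mod_cast this
    have h3 := hsumW
    rw [← hsplit] at h3
    have h4 : 2 * η * (N : ℝ) ^ 2 / K - (M : ℝ) ^ 2 * (η * K) ≤ #P * K := by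
      linarith only [h1, h2, h3]
    have h5 : η * (M : ℝ) ^ 2 * K ≤ 2 * η * (N : ℝ) ^ 2 / K - (M : ℝ) ^ 2 * (η * K) := by
      have h6 : (M : ℝ) ^ 2 * K ≤ (N : ℝ) ^ 2 / K := by
        have hMKN : (M : ℝ) * K ≤ N := by rwa [le_div_iff₀ hKr] at hMK
        have hsq : ((M : ℝ) * K) ^ 2 ≤ (N : ℝ) ^ 2 :=
          pow_le_pow_left₀ (by positivity) hMKN 2
        rw [le_div_iff₀ hKr]
        calc (M : ℝ) ^ 2 * K * K = ((M : ℝ) * K) ^ 2 := by ring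
          _ ≤ (N : ℝ) ^ 2 := hsq
      have h7 := mul_le_mul_of_nonneg_left h6 (show (0 : ℝ) ≤ 2 * η by positivity)
      have e1 : 2 * η * ((N : ℝ) ^ 2 / K) = 2 * η * (N : ℝ) ^ 2 / K := by ring
      have e2 : 2 * η * ((M : ℝ) ^ 2 * K) = η * (M : ℝ) ^ 2 * K + (M : ℝ) ^ 2 * (η * K) := by ring
      rw [e1, e2] at h7
      linarith only [h7]
    exact le_of_mul_le_mul_right (h5.trans h4) hKr
  -- Step 5: a popular `w'`
  have hPsum : (#P : ℝ) = ∑ w' ∈ Icc 1 M,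
      (#((Icc 1 M).filter fun w => η * K ≤ ‖W w w'‖) : ℝ) := by
    rw [hPdef, Finset.card_filter, Finset.sum_product_right]
    push_cast
    refine Finset.sum_congr rfl fun w' _ => ?_
    rw [Finset.card_filter]
    push_cast
    rfl
  obtain ⟨w', hw', hpop⟩ := exists_le_of_card_mul_le_sum (Icc 1 M)
    ⟨1, Finset.mem_Icc.mpr ⟨le_rfl, hM1⟩⟩
    (fun w' => (#((Icc 1 M).filter fun w => η * K ≤ ‖W w w'‖) : ℝ)) (X := η * M) (by
      rw [← hPsum, Nat.card_Icc]
      have : ((M + 1 - 1 : ℕ) : ℝ) = M := by simp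
      rw [this]
      linarith only [hPcard])
  refine ⟨K, huK, hKu, w', hw', ?_⟩
  -- Step 6: remove `w = w'` and rewrite `W` as an interval sum
  have hWint : ∀ w ∈ Icc 1 M, W w w' =
      ∑ d ∈ Ioc K (min (2 * K) (min (N / w) (N / w'))), F (d * w) * conj (F (d * w')) := by
    intro w hw
    have hw0 : 0 < w := (Finset.mem_Icc.mp hw).1
    have hw'0 : 0 < w' := (Finset.mem_Icc.mp hw').1
    have hterm : ∀ d, z d w * conj (z d w') =
        if d * w ≤ N ∧ d * w' ≤ N then F (d * w) * conj (F (d * w')) else 0 := by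
      intro d
      by_cases h1 : d * w ≤ N
      · by_cases h2 : d * w' ≤ N
        · simp only [hzdef, if_pos h1, if_pos h2, if_pos (And.intro h1 h2)]
        · simp only [hzdef, if_pos h1, if_neg h2, _root_.map_zero, mul_zero,
            if_neg (show ¬ (d * w ≤ N ∧ d * w' ≤ N) from fun h => h2 h.2)]
      · simp only [hzdef, if_neg h1, zero_mul,
          if_neg (show ¬ (d * w ≤ N ∧ d * w' ≤ N) from fun h => h1 h.1)]
    simp only [hWdef, hterm]
    rw [← Finset.sum_filter]
    congr 1
    ext d
    simp only [Finset.mem_filter, Finset.mem_Ioc, le_min_iff, Nat.le_div_iff_mul_le hw0,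
      Nat.le_div_iff_mul_le hw'0]
    tauto
  have hsub : ((Icc 1 M).filter fun w => η * K ≤ ‖W w w'‖) ⊆
      insert w' ((Icc 1 M).filter fun w => w ≠ w' ∧ η * K ≤
        ‖∑ d ∈ Ioc K (min (2 * K) (min (N / w) (N / w'))), F (d * w) * conj (F (d * w'))‖) := by
    intro w hw
    rw [Finset.mem_insert]
    by_cases hww : w = w'
    · exact Or.inl hww
    · right
      have hw1 := Finset.mem_filter.mp hw
      refine Finset.mem_filter.mpr ⟨hw1.1, hww, ?_⟩
      rw [← hWint w hw1.1]; exact hw1.2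
  have hcard := (Finset.card_le_card hsub).trans (Finset.card_insert_le _ _)
  have hcard' : (#((Icc 1 M).filter fun w => η * K ≤ ‖W w w'‖) : ℝ) ≤
      #((Icc 1 M).filter fun w => w ≠ w' ∧ η * K ≤
        ‖∑ d ∈ Ioc K (min (2 * K) (min (N / w) (N / w'))), F (d * w) * conj (F (d * w'))‖) + 1 := by
    have h := (Nat.cast_le (α := ℝ)).mpr hcard
    rwa [Nat.cast_add, Nat.cast_one] at h
  linarith only [hpop, hcard']

end Literature.NumberTheory.Sieve.QuadraticMoebius
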